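/-
Copyright (c) 2026 the pub-hodgecm-mathlib formalisation cell (harness21).  Prover seat hodgecm-mathlib-R90-IF-p01 (g0), programme R90-TF, section S9 «InnerForm-13.3.6 (c)»,
deal «G′-DATUM FIELDS (C5 posit-and-construct) for the DEFINITE INNER FORM» — the `Ch14Sec6.GlobalData` TERM `Γ₀^{sph}` (RULINGS R90-IF-plan 2026-09-04T21:39:45Z (2),
S9-R-K 21:58:49Z (4), S9-R-CMP v2 22:00:32Z (c)).
-/
import Summits.HodgeConjecture.HodgeConjecture.Theorems.R90S9InnerFormSec146Scope         -- ★ p862338 (this seat): `RepPrimeSph`, `classOfSph`, `mPrimeSph`, `mPrimeSph_ne_zero`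
import Summits.HodgeConjecture.HodgeConjecture.Theorems.R90S9InnerFormSec146Packets       -- ★ p862341 (this seat): `PacketPrime`, `memPrime`, `piXiPrime`, `evp`, `evpRep`, `IsPisAt` (ed. 1 via import)
import Literature.NumberTheory.Rogawski1990.Ch14Sec6                                      -- ★ `Ch14Sec6.GlobalData` (the §14.5–§14.6 dictionary datum), `GlobalPacketData`
import HarnessLib

/-!
# R90-TF · S9 — the §14.6 carpet instance `Γ₀^{sph} : Ch14Sec6.GlobalData` for the definite inner form `G′ = U(H)`: the TERM, with every OWED field a parameter
# (Rogawski 1990 §14.2 p. 233, §14.5 p. 237, §14.6 pp. 241–245)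

Cell `hodgecm-mathlib`, crux H413 = `stmt-HodgeConjecture-24833` (supports-only, count-neutral), route `HCCMUnconditional`; programme R90-TF, section S9, seat R90-IF-p01 (g0).
DEFINITIONS + `rfl` read-backs (`--kind definition`, review lane); no instance, no notation, no named-fact hypothesis, no `sorry`.  Siblings: ★ `R90S9InnerFormSec146Data` (ed. 1),
★ `R90S9InnerFormSec146Scope`, ★ `R90S9InnerFormSec146Packets`, ★ `R90S9InnerFormSec146PacketLaws` (ed. 2′).

WHAT THIS FILE IS.  ★ p862161 `R90.S9.definiteAeRigidity_of_parts` (R90-IF-p06, the (AE-ⅱ) junction cut) asks, at every `(L, H, …, ξ, μA, P)`, for ONE TERM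
`Γ : Ch14Sec6.GlobalData.{0} TG′ TG TH` whose `G′`-side fields are the S9 objects OF RECORD, so that the cut's PINS («`m′ π′ ≠ 0`», «E1 string ⟹ `evpRep`»,
«`mem′ π′ (Π′(ξ′))` READ BACK as `LocalConstituentsIn P (Ξ ξ′)`») unfold BY `rfl` against the record.  This file supplies that term, `gammaSph`, in the manner of S5-C2's
`gOfRecord` for the `G`-side: the fields this seat has CONSTRUCTED are fixed BY NAME —
`Place ∕ S ∕ S₀ ∕ DSplit ∕ cv` (ed. 1), `Rep′ := RepPrimeSph L ι H T hT μA` (the `K_c`-SPHERICAL discrete classes, RULING 21:39:45Z (2)(i)), `m′ := mPrimeSph`,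
`Packet′ := PacketPrime L H μA Ξ`, `mem′ := memPrime` (restricted), `PiXi′ ξ h₁ _ := piXiPrime (oneDimOf ξ h₁)`, `evp X Q := evp … X (finOfG Q)`,
`evpRep π′ Q := evpRep … π′.1 (finOfG Q)`, `IsPisAt` (ed. 1, against the second members of `Ξ (oneDimOf ξ _)`) — and EVERY OTHER FIELD IS A PARAMETER, bundled in the
structure `DatumInputs`: the `G`-side packet datum `G : GlobalPacketData` with its traces `tr ∕ trH`, one-dimensionality predicates and the READER `oneDimOf : IsOneDimH ρ → OneDimAutRepH L`
and `finOfG : G.Packet → GlobalPacket 𝔩` (S5-C ∕ S5-C2 currency — `gOfRecord` lives in a Lines file, which Theorems never import, so it is instantiated by the CONSUMER in B),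
the global traces `tr′ ∕ trP′ ∕ traceL` (OWED: S2 archimedean currency `archTr₀ ⊗ ∏ tr` through R90-IF-p02's components map, and `traceL := ⇑𝔨.traceGp` pinned by the
consumer's kit row, S9-R-K (1)), `psi′ ∕ AllPkt ∕ ofDisc ∕ trAll ∕ IsOneDim ∕ IsL2At` (Prop. 14.6.2 ∕ Thm. 14.6.3 vocabulary, off (B4)'s path), `MnNeZero` (S2), and the `ρ`-side
`LiftL2At ∕ PiRho′ ∕ sgn′ ∕ HasPinComponent` (Thm. 14.6.5, off path).  Programme law L8: nothing instance-specific beyond the record is frozen here.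

## Contents (namespace `Summit.HodgeConjecture.HodgeConjecture.R90.S9.InnerFormSec146`)
* §10 `DatumInputs` (the parameter bundle), **`gammaSph X : Ch14Sec6.GlobalData.{0} TG′ TG TH`**.
* §11 read-backs (`rfl` ∕ `Iff.rfl`): `gammaSph_Rep'`, `gammaSph_Packet'`, `gammaSph_G`, `gammaSph_m'`, `gammaSph_tr'`, `gammaSph_traceL`, `gammaSph_mem'`, `gammaSph_PiXi'`, `gammaSph_evp`,
  `gammaSph_evpRep`, `gammaSph_DSplit`, `gammaSph_S₀`, `gammaSph_isPisAt_inl_iff`, `gammaSph_not_isPisAt_inr`; the cut's pins at the datum: **`gammaSph_m'_ne_zero`** (anisotropic `H`),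
  **`gammaSph_evpRep_classOfSph`**, **`gammaSph_mem'_piXi'_classOfSph`** (= ★ `LocalConstituentsIn P (Ξ (oneDimOf ξ h₁))`), `gammaSph_evp_piXi'`, `gammaSph_dSplit`.
* §12 `s0_finite` (`S₀` finite — the first clause of `sec146_c`; `N = S₀.ncard`).
HONEST LABEL: bookkeeping (a structure term and its unfoldings); proves no printed statement about automorphic forms; HC_CM is proved only modulo the 7 printed citations
(2 remaining named inputs: hLiu418 = `stmt-HodgeConjecture-24832`, h413 = `stmt-HodgeConjecture-24833`) until rung 0 closes.

## References
* [Rogawski1990] J. D. Rogawski, *Automorphic Representations of Unitary Groups in Three Variables*, Ann. of Math. Stud. 123 (1990), §14.2 p. 233; §14.5 p. 237; §14.6 pp. 241–245.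
-/

set_option autoImplicit false
set_option linter.dupNamespace false  -- the mandated namespace repeats the summit's segment (`HodgeConjecture.HodgeConjecture`)

noncomputable section

open NumberField IsDedekindDomain MeasureTheory
open scoped Matrix MatrixGroups
open Literature.NumberTheory Literature.NumberTheory.Automorphic Literature.NumberTheory.Automorphic.UnitaryGroup
open Literature.NumberTheory.Rogawski1990
open Summit.HodgeConjecture.HodgeConjecture.Cruxes.H413 Summit.HodgeConjecture.HodgeConjecture.Cruxes.H413.F0P3ClassTokenChoice
open Summit.HodgeConjecture.HodgeConjecture.Cruxes.H413.F0P3GlobalPacket Summit.HodgeConjecture.HodgeConjecture.Cruxes.H413.F0P3LocalPacketKit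

namespace Summit.HodgeConjecture.HodgeConjecture.R90.S9.InnerFormSec146

/-! ## §10 The parameter bundle and the term `Γ₀^{sph}` -/

section Datum

variable (TG' TG TH : Type) (L : Type) [Field L] [NumberField L] [IsCMField L] (ι : L →+* ℂ) (H : Matrix (Fin 3) (Fin 3) L) (T : GL (Fin 3) ℂ)
  (hT : (T : Matrix (Fin 3) (Fin 3) ℂ)ᴴ * H.map ι * (T : Matrix (Fin 3) (Fin 3) ℂ) = Literature.Geometry.ComplexHyperbolic.BallModel.J)
  (μA : Measure (adelicGroupData (↥(maximalRealSubfield L)) L (IsCMField.complexConj L) 3 H).automorphicQuotient)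
  [(adelicGroupData (↥(maximalRealSubfield L)) L (IsCMField.complexConj L) 3 H).IsAutomorphicMeasure μA]
  (Ξ : OneDimAutRepH L → PacketPrimeFin L H) {H' : Matrix (Fin 3) (Fin 3) L}
  (𝔩 : ∀ v : HeightOneSpectrum (𝓞 ↥(maximalRealSubfield L)), LocalPacketKit L H' v)

/-- **The OWED ∕ foreign fields of the §14.6 datum for `G′ = U(H)`, as a parameter bundle**: the `G`-side packet datum of the quasi-split `G = U(Φ₃)` with its traces and
readers (`oneDimOf`: the global one-dimensional `ξ` underlying a one-dimensional `ρ ∈ Π(H)`; `finOfG`: the finite part `(Π_v)_v` of a packet of `G`, read at the kit `𝔩`),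
the global traces on `G′` (`tr′`, `trP′`, `θ_{G′} = traceL`), `ψ′` and the «all L-packets» vocabulary, `IsL2At`, `MnNeZero` (S2), and the `ρ`-side Thm. 14.6.5 vocabulary.
[cite: Rogawski1990, §14.5 p. 237; §14.6 pp. 241–245] -/
structure DatumInputs : Type 1 where
  /-- the discrete global packets of `G = U(Φ₃)` and `H = U(2) × U(1)` [§13.3] (S5-C2 `gOfRecord` at the consumer) -/
  G : GlobalPacketData.{0} TG TH
  /-- `Tr(π(f))` [§13.3 p. 203] -/
  tr : G.Rep → TG → ℂ
  /-- `Tr(ρ(f′^H))` [Thm. 14.6.1 p. 241] -/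
  trH : G.PacketH → TH → ℂ
  /-- `dim(Π) = 1` [Prop. 14.6.2 p. 242] -/
  IsOneDim : G.Packet → Prop
  /-- `ξ ∈ Π(H)` one-dimensional [Thm. 14.6.4 p. 244] -/
  IsOneDimH : G.PacketH → Prop
  /-- the global one-dimensional `ξ` underlying a one-dimensional `ρ ∈ Π(H)` [Thm. 14.6.4 p. 244] -/
  oneDimOf : (ρ : G.PacketH) → IsOneDimH ρ → OneDimAutRepH L
  /-- all global L-packets of `G` [§14.6 p. 242] -/
  AllPkt : Type
  /-- `Π(G) ⊂` all global L-packets [§14.6 p. 242] -/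
  ofDisc : G.Packet → AllPkt
  /-- `Tr(Π(f))` for a global L-packet of `G` [§14.6 p. 242] -/
  trAll : AllPkt → TG → ℂ
  /-- «`Π_v ∈ Π²(G_v)`» [Prop. 14.6.2 p. 242] -/
  IsL2At : G.Packet → Place L → Prop
  /-- the finite part `(Π_v)_v` of a packet of `G`, read at the kit `𝔩` [§13.3 p. 201] -/
  finOfG : G.Packet → GlobalPacket 𝔩
  /-- `Tr(π′(f′))` on the `K_c`-spherical discrete classes [§14.5 p. 237] (OWED: `archTr₀ ⊗ ∏ tr` through the components map) -/
  trPrime : RepPrimeSph L ι H T hT μA → TG' → ℂ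
  /-- `Tr(Π′(f′))` [§14.6 p. 242] -/
  trPPrime : PacketPrime L H μA Ξ → TG' → ℂ
  /-- `θ_{G′}(f′) = Tr(ρ_d(f′))` [§14.5 p. 237] (pinned `:= ⇑𝔨.traceGp` by the consumer's kit row) -/
  traceL : TG' → ℂ
  /-- `ψ′` [§14.6 p. 242] -/
  psi' : PacketPrime L H μA Ξ → AllPkt
  /-- `m_v · n_v ≠ 0` for `ξ_v`, `v ∈ S₀` [Thm. 14.6.4 p. 244] (S2) -/
  MnNeZero : G.PacketH → Place L → Prop
  /-- «`Π(ρ_v) ∈ Π²(G_v)`» [Thm. 14.6.5 p. 245] -/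
  LiftL2At : G.PacketH → Place L → Prop
  /-- `Π′(ρ)` [Thm. 14.6.5 p. 245] -/
  PiRho' : (ρ : G.PacketH) → (∀ p : Place L, p ∈ S0 L H → LiftL2At ρ p) → PacketPrime L H μA Ξ
  /-- `⟨s, π′⟩` [§14.6 p. 245] -/
  sgn' : Option G.PacketH → RepPrimeSph L ι H T hT μA → ℤ
  /-- some local component of `π′` is `πⁿ(ξ_v)` [Thm. 14.6.3 p. 243] -/
  HasPinComponent : RepPrimeSph L ι H T hT μA → Prop

/-- **`Γ₀^{sph}` — the §14.6 carpet instance for the definite inner form `G′ = U(H)`**: `Rep′ :=` the `K_c`-spherical discrete classes `RepPrimeSph`, `m′ := mPrimeSph`,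
`Packet′ := PacketPrime Ξ` (packets of record), `mem′ := memPrime`, `Π′(ξ) := piXiPrime (oneDimOf ξ _)`, `evp ∕ evpRep` read at the kit `𝔩` through `finOfG`,
`IsPisAt π′ ξ v` against the second members of `Ξ (oneDimOf ξ _)` at finite `v` (`False` at `∞` and for non-one-dimensional `ξ`), `Place ∕ S ∕ S₀ ∕ DSplit ∕ cv` of edition 1;
everything else from the bundle `X`. [cite: Rogawski1990, §14.5 p. 237; §14.6 pp. 241–245] -/
def gammaSph (X : DatumInputs TG' TG TH L ι H T hT μA Ξ 𝔩) : Ch14Sec6.GlobalData.{0} TG' TG TH where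
  G := X.G
  tr := X.tr
  trH := X.trH
  IsOneDim := X.IsOneDim
  IsOneDimH := X.IsOneDimH
  AllPkt := X.AllPkt
  ofDisc := X.ofDisc
  trAll := X.trAll
  Place := Place L
  S := S L
  S₀ := S0 L H
  DSplit := DSplit L H
  IsL2At := X.IsL2At
  cv := cv L H
  Rep' := RepPrimeSph L ι H T hT μA
  m' := mPrimeSph L ι H T hT μA
  tr' := X.trPrime
  traceL := X.traceL
  Packet' := PacketPrime L H μA Ξ
  mem' := fun π' P' => memPrime L H μA Ξ π'.1 P'
  trP' := X.trPPrime
  psi' := X.psi'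
  evp := fun P' Q => evp L H μA Ξ 𝔩 P' (X.finOfG Q)
  evpRep := fun π' Q => evpRep L H μA 𝔩 π'.1 (X.finOfG Q)
  MnNeZero := X.MnNeZero
  PiXi' := fun ξ h₁ _ => piXiPrime L H μA Ξ (X.oneDimOf ξ h₁)
  IsPisAt := fun π' ξ p => match p with
    | Sum.inl v => ∃ h₁ : X.IsOneDimH ξ, IsPisAt L H μA π'.1 (fun w => (Ξ (X.oneDimOf ξ h₁) w).πs) v
    | Sum.inr _ => False
  LiftL2At := X.LiftL2At
  PiRho' := X.PiRho'
  sgn' := X.sgn'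
  HasPinComponent := X.HasPinComponent

/-! ## §11 Read-backs (`rfl`) and the (AE-ⅱ) cut's pins at the datum -/

variable (X : DatumInputs TG' TG TH L ι H T hT μA Ξ 𝔩)

/-- `Γ₀^{sph}.Rep′ = RepPrimeSph` (unfolding). [cite: Rogawski1990, §14.5 p. 237] -/
theorem gammaSph_Rep' : (gammaSph TG' TG TH L ι H T hT μA Ξ 𝔩 X).Rep' = RepPrimeSph L ι H T hT μA := rfl

/-- `Γ₀^{sph}.Packet′ = PacketPrime Ξ` (unfolding). [cite: Rogawski1990, §14.6 p. 242] -/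
theorem gammaSph_Packet' : (gammaSph TG' TG TH L ι H T hT μA Ξ 𝔩 X).Packet' = PacketPrime L H μA Ξ := rfl

/-- `Γ₀^{sph}.G = X.G` (unfolding). [cite: Rogawski1990, §13.3 p. 201] -/
theorem gammaSph_G : (gammaSph TG' TG TH L ι H T hT μA Ξ 𝔩 X).G = X.G := rfl

/-- `Γ₀^{sph}.m′ = mPrimeSph` (unfolding). [cite: Rogawski1990, §14.5 p. 237] -/
theorem gammaSph_m' (π' : RepPrimeSph L ι H T hT μA) : (gammaSph TG' TG TH L ι H T hT μA Ξ 𝔩 X).m' π' = mPrimeSph L ι H T hT μA π' := rfl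

/-- `Γ₀^{sph}.tr′ = X.trPrime` (unfolding; the OWED archimedean currency enters here only). [cite: Rogawski1990, §14.5 p. 237] -/
theorem gammaSph_tr' (π' : RepPrimeSph L ι H T hT μA) (f' : TG') : (gammaSph TG' TG TH L ι H T hT μA Ξ 𝔩 X).tr' π' f' = X.trPrime π' f' := rfl

/-- `Γ₀^{sph}.traceL = X.traceL` (unfolding; `:= ⇑𝔨.traceGp` at the consumer). [cite: Rogawski1990, §14.5 p. 237] -/
theorem gammaSph_traceL (f' : TG') : (gammaSph TG' TG TH L ι H T hT μA Ξ 𝔩 X).traceL f' = X.traceL f' := rfl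

/-- `Γ₀^{sph}.mem′ π′ Π′ ↔ memPrime π′.1 Π′` (unfolding). [cite: Rogawski1990, §14.6 p. 242] -/
theorem gammaSph_mem' (π' : RepPrimeSph L ι H T hT μA) (P' : PacketPrime L H μA Ξ) :
    (gammaSph TG' TG TH L ι H T hT μA Ξ 𝔩 X).mem' π' P' ↔ memPrime L H μA Ξ π'.1 P' := Iff.rfl

/-- `Γ₀^{sph}.PiXi′ ξ h₁ hS = piXiPrime (oneDimOf ξ h₁)` (unfolding; the `MnNeZero` witness is not read by the finite part). [cite: Rogawski1990, Thm. 14.6.4 p. 244] -/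
theorem gammaSph_PiXi' (ξ : X.G.PacketH) (h₁ : X.IsOneDimH ξ) (hS : ∀ p : Place L, p ∈ S0 L H → X.MnNeZero ξ p) :
    (gammaSph TG' TG TH L ι H T hT μA Ξ 𝔩 X).PiXi' ξ h₁ hS = piXiPrime L H μA Ξ (X.oneDimOf ξ h₁) := rfl

/-- `Γ₀^{sph}.evp Π′ Π ↔ evp … Π′ (finOfG Π)` (unfolding). [cite: Rogawski1990, §14.6 p. 242] -/
theorem gammaSph_evp (P' : PacketPrime L H μA Ξ) (Q : X.G.Packet) :
    (gammaSph TG' TG TH L ι H T hT μA Ξ 𝔩 X).evp P' Q ↔ evp L H μA Ξ 𝔩 P' (X.finOfG Q) := Iff.rfl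

/-- `Γ₀^{sph}.evpRep π′ Π ↔ evpRep … π′.1 (finOfG Π)` (unfolding). [cite: Rogawski1990, §14.6 p. 242] -/
theorem gammaSph_evpRep (π' : RepPrimeSph L ι H T hT μA) (Q : X.G.Packet) :
    (gammaSph TG' TG TH L ι H T hT μA Ξ 𝔩 X).evpRep π' Q ↔ evpRep L H μA 𝔩 π'.1 (X.finOfG Q) := Iff.rfl

/-- `Γ₀^{sph}.DSplit = DSplit H` (unfolding). [cite: Rogawski1990, §14.6 p. 243] -/
theorem gammaSph_DSplit : (gammaSph TG' TG TH L ι H T hT μA Ξ 𝔩 X).DSplit = DSplit L H := rfl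

/-- **`D = M₃(E)` holds at the datum.** [cite: Rogawski1990, §14.6 p. 243] -/
theorem gammaSph_dSplit : (gammaSph TG' TG TH L ι H T hT μA Ξ 𝔩 X).DSplit := dSplit L H

/-- `Γ₀^{sph}.S₀ = S0 L H` (unfolding). [cite: Rogawski1990, §14.2 p. 233] -/
theorem gammaSph_S₀ : (gammaSph TG' TG TH L ι H T hT μA Ξ 𝔩 X).S₀ = S0 L H := rfl

/-- **PIN «`m′ π′ ≠ 0`» at the datum** (anisotropic `H`): every `K_c`-spherical discrete class occurs in `L²_disc` (★ `mPrimeSph_ne_zero`). [cite: Rogawski1990, §14.5 p. 237] -/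
theorem gammaSph_m'_ne_zero (hanis : ∀ x : Fin 3 → L, Literature.AlgebraicGeometry.ShimuraVarieties.hermForm (cmConjRingHom L) H x x = 0 → x = 0)
    (π' : RepPrimeSph L ι H T hT μA) : (gammaSph TG' TG TH L ι H T hT μA Ξ 𝔩 X).m' π' ≠ 0 :=
  mPrimeSph_ne_zero L ι H T hT μA hanis π'

/-- **PIN «`t(π′) = t(Π)`» at the datum, for `π′ = [P]`**: `Γ₀^{sph}.evpRep (classOfSph P hP) Π ↔ evpRepOf P (finOfG Π)` — for almost all `v` the chosen class ★ `clFinChoice P v`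
transports to `sph (Π.loc v)` along every level-matching frame. [cite: Rogawski1990, §14.6 p. 242; §13.7 p. 206] -/
theorem gammaSph_evpRep_classOfSph (P : DiscreteAutomorphicRep (adelicGroupData (↥(maximalRealSubfield L)) L (IsCMField.complexConj L) 3 H) μA)
    (hP : IsKcSpherical L ι H T hT μA P) (Q : X.G.Packet) :
    (gammaSph TG' TG TH L ι H T hT μA Ξ 𝔩 X).evpRep (classOfSph L ι H T hT μA P hP) Q ↔ evpRepOf L H μA 𝔩 P (X.finOfG Q) := Iff.rfl

/-- **PIN «`π′ ∈ Π′(ξ)` READ BACK» at the datum, for `π′ = [P]`**: `Γ₀^{sph}.mem′ (classOfSph P hP) (Γ₀^{sph}.PiXi′ ξ h₁ hS) ↔ LocalConstituentsIn P (Ξ (oneDimOf ξ h₁))`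
(★ `memPrime_piXiPrime_iff`). [cite: Rogawski1990, Thm. 14.6.4 p. 244; §13.3 p. 201] -/
theorem gammaSph_mem'_piXi'_classOfSph (P : DiscreteAutomorphicRep (adelicGroupData (↥(maximalRealSubfield L)) L (IsCMField.complexConj L) 3 H) μA)
    (hP : IsKcSpherical L ι H T hT μA P) (ξ : X.G.PacketH) (h₁ : X.IsOneDimH ξ) (hS : ∀ p : Place L, p ∈ S0 L H → X.MnNeZero ξ p) :
    (gammaSph TG' TG TH L ι H T hT μA Ξ 𝔩 X).mem' (classOfSph L ι H T hT μA P hP) ((gammaSph TG' TG TH L ι H T hT μA Ξ 𝔩 X).PiXi' ξ h₁ hS) ↔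
      LocalConstituentsIn P (Ξ (X.oneDimOf ξ h₁)) :=
  Iff.rfl

/-- **PIN «`t(Π′(ξ)) = t(Π)`» at the datum**: `Γ₀^{sph}.evp (Γ₀^{sph}.PiXi′ ξ h₁ hS) Π ↔ evpFin (Ξ (oneDimOf ξ h₁)) (finOfG Π)` (★ `evp_piXiPrime_iff`). [cite: Rogawski1990, §14.6 p. 242] -/
theorem gammaSph_evp_piXi' (ξ : X.G.PacketH) (h₁ : X.IsOneDimH ξ) (hS : ∀ p : Place L, p ∈ S0 L H → X.MnNeZero ξ p) (Q : X.G.Packet) :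
    (gammaSph TG' TG TH L ι H T hT μA Ξ 𝔩 X).evp ((gammaSph TG' TG TH L ι H T hT μA Ξ 𝔩 X).PiXi' ξ h₁ hS) Q ↔ evpFin L H 𝔩 (Ξ (X.oneDimOf ξ h₁)) (X.finOfG Q) :=
  Iff.rfl

/-- `Γ₀^{sph}.IsPisAt (classOfSph P hP) ξ (inl v)` unfolded: for some (any) one-dimensionality witness, the `v`-constituents of `P` are the second member of `Ξ (oneDimOf ξ _) v`.
[cite: Rogawski1990, Thm. 14.6.4 p. 244] -/
theorem gammaSph_isPisAt_inl_iff (π' : RepPrimeSph L ι H T hT μA) (ξ : X.G.PacketH) (v : HeightOneSpectrum (𝓞 ↥(maximalRealSubfield L))) :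
    (gammaSph TG' TG TH L ι H T hT μA Ξ 𝔩 X).IsPisAt π' ξ (Sum.inl v) ↔
      ∃ h₁ : X.IsOneDimH ξ, IsPisAt L H μA π'.1 (fun w => (Ξ (X.oneDimOf ξ h₁) w).πs) v :=
  Iff.rfl

/-- `Γ₀^{sph}.IsPisAt π′ ξ (inr w)` is `False`: «`π′_v = πˢ(ξ_v)`» is asked only at finite `v ∉ S₀` in print. [cite: Rogawski1990, Thm. 14.6.4 p. 244] -/
theorem gammaSph_not_isPisAt_inr (π' : RepPrimeSph L ι H T hT μA) (ξ : X.G.PacketH) (w : InfinitePlace L) :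
    ¬ (gammaSph TG' TG TH L ι H T hT μA Ξ 𝔩 X).IsPisAt π' ξ (Sum.inr w) :=
  fun h => h

end Datum

/-! ## §12 `S₀` is finite (first clause of `sec146_c` at the datum) -/

section Finite

variable (L : Type) [Field L] [NumberField L] [IsCMField L] (H : Matrix (Fin 3) (Fin 3) L)

omit [IsCMField L] in
/-- **`S₀` is finite**: it consists of archimedean places, of which a number field has finitely many. [cite: Rogawski1990, §14.2 p. 233; §14.6 p. 244 «`N = Card(S₀)`»] -/
theorem s0_finite : (S0 L H).Finite :=
  (Set.finite_range (Sum.inr : InfinitePlace L → Place L)).subset fun p hp => by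
    obtain ⟨w, rfl, -⟩ := hp
    exact ⟨w, rfl⟩

end Finite

end Summit.HodgeConjecture.HodgeConjecture.R90.S9.InnerFormSec146

end
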